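import Literature.Geometry.Symplectic.ZeroCircleTubularChart
import Literature.Geometry.Symplectic.ZeroCircleGradientFamily
import Literature.Geometry.Symplectic.AdaptedFrameBlock
import Literature.Geometry.Symplectic.NearSymplecticDefinite
import HarnessLib

/-!
# A tubular chart about an even zero circle with block-diagonal adapted frame

Topic `Geometry/Symplectic`; namespace `Literature.Geometry.Symplectic`.  Theorems only; no named
fact, no `sorry`.  Assembly of the tubular chart (`IsZeroCircle.exists_tubularChart`), the
gradient-family package (`ZeroCircleGradientFamily`) and the block frame
(`exists_contDiff_blockFrame`): for a strictly near-symplectic form `sf` (Perutz's Def. 1.1 with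
definite gradient image) and an EVEN zero circle `γ`, inside any open `N ⊇ γ(ℝ)` there are

* a `2π`-periodic tubular chart `χ : ℝ⁴ → M` about `γ` (`C^∞`, immersive and injective modulo
  `2πℤ e₀` on a model tube `hondaTube r`, `χ(hondaTube r) ⊆ N`, `χ(θ e₀) = γ(θ)`), on whose tube
  the zeros of `sf` are exactly the axis;
* a `C^∞` `2π`-periodic family of linear automorphisms `A(θ)` of `ℝ⁴` fixing `e₀`, a sign
  `σ = ±1` and a `C^∞` periodic symmetric BLOCK matrix `M(θ) = M⁺(θ) ⊕ (m₃₃(θ))`,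
  `M⁺(θ) > 0`, `m₃₃(θ) < 0`,

such that the `1`-jet of `χ^* sf` at the axis reads, in the frame `A(θ)`,
`∇(χ^*sf)_{θe₀}(A W)(A U, A V) = σ Σ_k (M(θ) x(W))_k β_k(U, V)` (`x(W)` the normal part of `W`,
`β_k` Honda's forms) — Perutz's "`ω(t, x) = x·S(t)β + O(x²)` with `S(t) = S⁺(t) ⊕ S⁻(t)`" for an
even circle (proof of Lemma 3.1, step 1), obtained here without a metric.

## References

* T. Perutz, *Zero-sets of near-symplectic forms*, J. Symplectic Geom. 4 (2006), §2.3, Prop. 2.2,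
  Lemma 3.1. [Perutz2006]
* K. Honda, *Local properties of self-dual harmonic 2-forms on a 4-manifold*, J. reine angew.
  Math. 577 (2004), Thm. 5. [Honda2004LocalSD]
-/

noncomputable section

open scoped Manifold ContDiff Topology Real Matrix
open Set Function Bundle Filter Module Matrix Literature.Topology.FourManifolds
  Literature.Geometry.Lorentzian Literature.Geometry.Kaehler

namespace Literature.Geometry.Symplectic

universe u

variable {M : Type u} [TopologicalSpace M] [ChartedSpace (EuclideanSpace ℝ (Fin 4)) M]
  [IsManifold (𝓡 4) ∞ M] [T2Space M] [SigmaCompactSpace M]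

/-- **Tubular chart with block-diagonal adapted frame about an even zero circle** (Perutz 2006,
proof of Lemma 3.1, step 1, for an even circle; Honda 2004, proof of Thm. 5).
[cite: Perutz2006, Lemma 3.1 (proof, step 1)] -/
theorem IsEvenZeroCircle.exists_blockChart (o : SmoothOrientation (𝓡 4) M)
    {sf : MForm (𝓡 4) M ℝ 2} {γ : ℝ → M} (hsf : IsStrictlyNearSymplectic o sf)
    (h : IsEvenZeroCircle sf γ) {N : Set M} (hN : IsOpen N) (hγN : range γ ⊆ N) :
    ∃ (r : ℝ) (χ : EuclideanSpace ℝ (Fin 4) → M)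
      (A : ℝ → (EuclideanSpace ℝ (Fin 4) ≃L[ℝ] EuclideanSpace ℝ (Fin 4))) (σ : ℝ)
      (Mb : ℝ → Matrix (Fin 3) (Fin 3) ℝ),
      0 < r ∧
      (∀ q, χ (q + (2 * π) • EuclideanSpace.single 0 1) = χ q) ∧
      ContMDiffOn 𝓘(ℝ, EuclideanSpace ℝ (Fin 4)) (𝓡 4) ∞ χ (hondaTube r) ∧
      (∀ q ∈ hondaTube r, ∀ q' ∈ hondaTube r, χ q' = χ q →
        ∃ k : ℤ, q' = q + (2 * π * k) • EuclideanSpace.single 0 1) ∧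
      (∀ q ∈ hondaTube r, Injective (mfderiv 𝓘(ℝ, EuclideanSpace ℝ (Fin 4)) (𝓡 4) χ q)) ∧
      χ '' hondaTube r ⊆ N ∧
      (∀ q ∈ hondaAxis, χ q = γ (q 0)) ∧
      χ '' hondaAxis = range γ ∧
      zeroLocus sf ∩ χ '' hondaTube r = χ '' hondaAxis ∧
      (∀ u, ContDiff ℝ ∞ fun θ ↦ A θ u) ∧ (∀ i j, ContDiff ℝ ∞ fun θ ↦ Mb θ i j) ∧
      (σ = 1 ∨ σ = -1) ∧ (∀ θ, A θ (stdVec 0) = stdVec 0) ∧ (∀ θ, (Mb θ).IsSymm) ∧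
      (∀ θ (m : Fin 3), Mb θ m 2 = if m = 2 then Mb θ 2 2 else 0) ∧ (∀ θ, Mb θ 2 2 < 0) ∧
      (∀ θ (v : Fin 3 → ℝ), v 2 = 0 → v ≠ 0 → 0 < v ⬝ᵥ Mb θ *ᵥ v) ∧
      (∀ θ W U V, zeroGradient (sf.pullback 𝓘(ℝ, EuclideanSpace ℝ (Fin 4)) χ) (hondaAxisPoint θ)
          (A θ W) ![A θ U, A θ V] = σ * ∑ k, (Mb θ *ᵥ normalPart W) k * hondaBetaVec U V k) ∧
      (∀ θ, A (θ + 2 * π) = A θ) ∧ (∀ θ, Mb (θ + 2 * π) = Mb θ) := by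
  -- the tubular chart
  obtain ⟨ν, r₀, χ, hνs, hνper, hνli, hν0, hr₀, hχper, hχs₀, hχinj₀, hχimm₀, hχN₀, hχγ, hχax,
    hdχ⟩ := h.isZeroCircle.exists_tubularChart o hN hγN
  have hsm : IsSmoothForm sf := hsf.isSmoothForm
  have hcl : IsClosedForm sf := hsf.isClosedForm
  have hpos : ∀ θ, IsPositiveZero o sf (γ θ) := fun θ ↦
    hsf.isStrictlyNearPositive.isPositiveZero_of_mem (h.isZeroCircle.mem_zeroLocus θ)
  have hT : ∀ θ, IsTransverseZero sf (γ θ) := fun θ ↦ (hpos θ).isTransverseZero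
  have hZ : ∀ θ, sf (γ θ) = 0 := fun θ ↦ (hpos θ).mem_zeroLocus
  -- shrink the tube so that the zeros in it are on the axis
  obtain ⟨r, hr, hrr₀, hzero⟩ := exists_radius_zeroLocus_inter_image_eq hr₀ hχs₀ hχper hχimm₀ hχγ
    (fun q _ ↦ hsm (χ q)) hT
  have hsub : hondaTube r ⊆ hondaTube r₀ := hondaTube_mono hr.le hrr₀
  have hχs : ContMDiffOn 𝓘(ℝ, EuclideanSpace ℝ (Fin 4)) (𝓡 4) ∞ χ (hondaTube r) := hχs₀.mono hsub
  have hχimm : ∀ q ∈ hondaTube r,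
      Injective (mfderiv 𝓘(ℝ, EuclideanSpace ℝ (Fin 4)) (𝓡 4) χ q) :=
    fun q hq ↦ hχimm₀ q (hsub hq)
  -- the gradient family and its hypotheses
  set J := fun θ ↦ zeroGradient (sf.pullback 𝓘(ℝ, EuclideanSpace ℝ (Fin 4)) χ) (hondaAxisPoint θ)
    with hJ
  have hJs : ∀ W, ContDiff ℝ ∞ fun θ ↦ J θ W := contDiff_zeroGradient_pullback_axis hr hχs hsm
  have hJ0 : ∀ θ, J θ (stdVec 0) = 0 := zeroGradient_pullback_axis_stdVec_zero hr hχs hsm hχγ hZ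
  have hsym : ∀ θ p q, J θ p ![stdVec 0, q] = J θ q ![stdVec 0, p] :=
    zeroGradient_pullback_axis_symm hr hχs hsm hcl hχγ hZ
  have hrank : ∀ θ, Module.finrank ℝ (LinearMap.range (J θ).toLinearMap) = 3 :=
    finrank_range_zeroGradient_pullback_axis hr hχs hχimm hsm hχγ hT
  obtain ⟨s, hs, hdef⟩ := exists_sign_zeroGradient_pullback_axis o hr hχs hχimm hsm hχγ hpos
  have hJP : ∀ θ, J (θ + 2 * π) = J θ := zeroGradient_pullback_axis_periodic hr hχs hχper
  -- the seed
  obtain ⟨V, hVper, hVc, hVmin⟩ := h.exists_section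
  have hdχ0 : ∀ θ, mfderiv 𝓘(ℝ, EuclideanSpace ℝ (Fin 4)) (𝓡 4) χ (hondaAxisPoint θ) (stdVec 0) =
      zeroCircleTangent γ θ := by
    intro θ
    rw [hdχ _ (hondaAxisPoint_mem_hondaAxis θ), hondaAxisPoint_apply_zero]
    have h0 : (stdVec 0 : EuclideanSpace ℝ (Fin 4)) 0 = 1 := by simp [stdVec]
    have hb : ∀ b : Fin 3, (stdVec 0 : EuclideanSpace ℝ (Fin 4)) b.succ = 0 := fun b ↦ by
      simp [stdVec, Fin.succ_ne_zero]
    simp only [h0, one_smul, hb, zero_smul, Finset.sum_const_zero, add_zero]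
    rfl
  have hdχsucc : ∀ θ (a : Fin 3), mfderiv 𝓘(ℝ, EuclideanSpace ℝ (Fin 4)) (𝓡 4) χ
      (hondaAxisPoint θ) (stdVec a.succ) = ν a.succ θ := by
    intro θ a
    rw [hdχ _ (hondaAxisPoint_mem_hondaAxis θ), hondaAxisPoint_apply_zero]
    have h0 : (stdVec a.succ : EuclideanSpace ℝ (Fin 4)) 0 = 0 := by
      simp [stdVec, (Fin.succ_ne_zero a).symm]
    have hb : ∀ b : Fin 3,
        (stdVec a.succ : EuclideanSpace ℝ (Fin 4)) b.succ = if b = a then 1 else 0 := fun b ↦ by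
      simp [stdVec, Fin.succ_inj, eq_comm]
    simp only [h0, zero_smul, zero_add, hb, ite_smul, one_smul, zero_smul,
      Finset.sum_ite_eq', Finset.mem_univ, if_true]
  obtain ⟨w, hwc, -, hwper, hwmin⟩ := exists_continuous_minority_seed hr hχs hχper hχimm hsm hχγ
    hZ h.isZeroCircle.contMDiff (ν := fun a θ ↦ ν a.succ θ)
    (fun a ↦ (hνs a.succ).continuous) hdχ0 hdχsucc hVper hVc hVmin
  -- the block frame
  obtain ⟨A, σ, Mb, hAs, hMs, hσ, hA0, hMsym, hblock, hneg, hposb, hgrad, hAP, hMP⟩ :=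
    exists_contDiff_blockFrame hJs hs hrank hdef hJ0 hsym hwc hwmin hJP hwper
  exact ⟨r, χ, A, σ, Mb, hr, hχper, hχs, fun q hq q' hq' hqq ↦ hχinj₀ q (hsub hq) q' (hsub hq') hqq,
    hχimm, (Set.image_mono hsub).trans hχN₀, hχγ, hχax, hzero, hAs, hMs, hσ, hA0, hMsym, hblock,
    hneg, hposb, hgrad, hAP, hMP⟩

end Literature.Geometry.Symplectic

end
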